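import Summits.QuantumFields.YangMills.Theorems.F4SubCurvatureDoorSmearedSlices
import Summits.QuantumFields.YangMills.Theorems.F4SubCurvatureDoorLaplaceFourierRegistered
import Mathlib
import HarnessLib

/-!
# LINE g21-A/g21-B (⟨stmt-QuantumFields-23125⟩) — S2 helper: line derivatives of WEIGHTED Laplace–Fourier integrals

Helper toward the registered stub S2 `stub_shellSeparation` (shared by `Cruxes/RationalToGeneral/Lines/shell_separation.lean` and
`Lines/fibre_dichotomy.lean`).  For a measure `μ` on momentum space `ℝ × ℝ³` carried by `E ≥ 0`, Laplace-integrable (`∫ e^{−tE} dμ < ∞` for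
`t > 0`) and with `‖q⃗‖ ≤ E + A` a.e. (which is what «no deep space-like mass» `E² − ‖q⃗‖² ≥ −Q₀` gives), and a measurable WEIGHT `W` with
polynomial growth `|W| ≤ C (1 + E)^m` a.e., the weighted Laplace–Fourier integrals `s ↦ ∫ W e^{−sE} g dμ` and
`s ↦ ∫ W e^{−tE} g(⟪q⃗, z⃗⟫ + s qⱼ) dμ` are differentiable with the expected derivatives (dominated differentiation), and the weights
`W·E`, `W·qⱼ` are again of polynomial growth — so the computation iterates.  This is step (2) of the shell-separation mechanism
(«the Laplacian is multiplication by the mass squared», rung R-S2a ✓p716500 for `k = 1`) prepared for ALL orders `k`.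

Mathlib + tree only; no `sorry`; no new definitions.  HONEST LABEL: calculus helper for a registered stub of an OPEN line; S1, S2, ⟨23125⟩,
⟨23035⟩, R2d and the Yang–Mills mass gap remain OPEN; no summit is proved by a line.
-/

noncomputable section

open MeasureTheory Set Filter Topology
open scoped BigOperators

namespace Summit.QuantumFields.YangMills.Theorems.F4SubCurvatureDoorShellSeparationProof

open Summit.QuantumFields.YangMills.Theorems.F4SubCurvatureDoorLaplaceFourierRegistered (E4 E3)
open Summit.QuantumFields.YangMills.Theorems.F4SubCurvatureDoorSmearedSlices (ae_nonneg_of_measure_Iio integrable_pow_mul_exp_mul)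

variable {μ : Measure (ℝ × E3)}

/-! ## Polynomial weights against `e^{−tE}` -/

/-- **Integrability of polynomially weighted Laplace–Fourier integrands**: `|W| ≤ C(1+E)^m` a.e., `|g| ≤ 1` ⇒ `W e^{−tE} g ∈ L¹(μ)`. -/
theorem integrable_weight (h0 : μ (Set.Iio (0 : ℝ) ×ˢ (Set.univ : Set E3)) = 0)
    (hint : ∀ t : ℝ, 0 < t → Integrable (fun p : ℝ × E3 => Real.exp (-(t * p.1))) μ)
    {W : ℝ × E3 → ℝ} (hWm : Measurable W) {C : ℝ} {m : ℕ} (hWb : ∀ᵐ p ∂μ, |W p| ≤ C * (1 + p.1) ^ m)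
    {g : ℝ × E3 → ℝ} (hgm : Measurable g) (hgb : ∀ p, |g p| ≤ 1) {t : ℝ} (ht : 0 < t) :
    Integrable (fun p : ℝ × E3 => W p * Real.exp (-(t * p.1)) * g p) μ := by
  -- dominating function `|C| 2^m (e^{−tE} + E^m e^{−tE})`
  have hd1 : Integrable (fun p : ℝ × E3 => Real.exp (-(t * p.1))) μ := hint t ht
  have hd2 : Integrable (fun p : ℝ × E3 => p.1 ^ m * Real.exp (-(t * p.1)) * (1 : ℝ)) μ :=
    integrable_pow_mul_exp_mul μ h0 hint (fun _ => (1 : ℝ)) measurable_const (C := 1) (fun _ => by simp) ht m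
  refine ((hd1.add hd2).const_mul (|C| * 2 ^ m)).mono' ?_ ?_
  · exact ((hWm.mul (by fun_prop)).mul hgm).aestronglyMeasurable
  · filter_upwards [hWb, ae_nonneg_of_measure_Iio μ h0] with p hp hE
    rw [Real.norm_eq_abs, abs_mul, abs_mul, abs_of_pos (Real.exp_pos _)]
    have hexp : 0 < Real.exp (-(t * p.1)) := Real.exp_pos _
    have h1 : |W p| ≤ |C| * (1 + p.1) ^ m := hp.trans (mul_le_mul_of_nonneg_right (le_abs_self C) (by positivity))
    have h2 : (1 + p.1) ^ m ≤ 2 ^ m * (1 + p.1 ^ m) := by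
      -- `(1 + E)^m ≤ (2 max(1,E))^m = 2^m max(1,E)^m ≤ 2^m (1 + E^m)`
      have h1' : 1 + p.1 ≤ 2 * max 1 p.1 := by
        rcases le_total 1 p.1 with h | h
        · rw [max_eq_right h]; linarith
        · rw [max_eq_left h]; linarith
      have h3 : (max 1 p.1) ^ m ≤ 1 + p.1 ^ m := by
        rcases le_total 1 p.1 with h | h
        · rw [max_eq_right h]; linarith [pow_nonneg hE m]
        · rw [max_eq_left h, one_pow]; linarith [pow_nonneg hE m]
      calc (1 + p.1) ^ m ≤ (2 * max 1 p.1) ^ m := pow_le_pow_left₀ (by linarith) h1' m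
        _ = 2 ^ m * (max 1 p.1) ^ m := mul_pow _ _ _
        _ ≤ 2 ^ m * (1 + p.1 ^ m) := mul_le_mul_of_nonneg_left h3 (by positivity)
    calc |W p| * Real.exp (-(t * p.1)) * |g p| ≤ |C| * (2 ^ m * (1 + p.1 ^ m)) * Real.exp (-(t * p.1)) * 1 := by
          gcongr
          · exact h1.trans (mul_le_mul_of_nonneg_left h2 (abs_nonneg _))
          · exact hgb p
      _ = |C| * 2 ^ m * (Real.exp (-(t * p.1)) + p.1 ^ m * Real.exp (-(t * p.1)) * 1) := by ring

/-- **Weight closure under `E`**: `W ↦ W·E` raises the growth exponent by one. -/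
theorem weight_mul_energy (h0 : μ (Set.Iio (0 : ℝ) ×ˢ (Set.univ : Set E3)) = 0)
    {W : ℝ × E3 → ℝ} {C : ℝ} {m : ℕ} (hC : 0 ≤ C) (hWb : ∀ᵐ p ∂μ, |W p| ≤ C * (1 + p.1) ^ m) :
    ∀ᵐ p ∂μ, |W p * p.1| ≤ C * (1 + p.1) ^ (m + 1) := by
  filter_upwards [hWb, ae_nonneg_of_measure_Iio μ h0] with p hp hE
  rw [abs_mul, abs_of_nonneg hE, pow_succ]
  calc |W p| * p.1 ≤ C * (1 + p.1) ^ m * p.1 := mul_le_mul_of_nonneg_right hp hE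
    _ ≤ C * (1 + p.1) ^ m * (1 + p.1) := mul_le_mul_of_nonneg_left (by linarith) (by positivity)
    _ = C * ((1 + p.1) ^ m * (1 + p.1)) := by ring

/-- **Weight closure under `qⱼ`** (when `‖q⃗‖ ≤ E + A` a.e.): `W ↦ W·qⱼ` raises the growth exponent by one and the constant by `(1+A)`. -/
theorem weight_mul_momentum (h0 : μ (Set.Iio (0 : ℝ) ×ˢ (Set.univ : Set E3)) = 0) {A : ℝ} (hA : 0 ≤ A)
    (hq : ∀ᵐ p ∂μ, ‖p.2‖ ≤ p.1 + A) {W : ℝ × E3 → ℝ} {C : ℝ} {m : ℕ} (hC : 0 ≤ C)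
    (hWb : ∀ᵐ p ∂μ, |W p| ≤ C * (1 + p.1) ^ m) (j : Fin 3) :
    ∀ᵐ p ∂μ, |W p * p.2 j| ≤ C * (1 + A) * (1 + p.1) ^ (m + 1) := by
  filter_upwards [hWb, hq, ae_nonneg_of_measure_Iio μ h0] with p hp hpq hE
  have hcoord : |p.2 j| ≤ ‖p.2‖ := by
    have := PiLp.norm_apply_le p.2 j
    rwa [Real.norm_eq_abs] at this
  have hj : |p.2 j| ≤ (1 + A) * (1 + p.1) := by
    have := hcoord.trans hpq
    nlinarith
  rw [abs_mul, pow_succ]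
  calc |W p| * |p.2 j| ≤ C * (1 + p.1) ^ m * ((1 + A) * (1 + p.1)) :=
        mul_le_mul hp hj (abs_nonneg _) (by positivity)
    _ = C * (1 + A) * ((1 + p.1) ^ m * (1 + p.1)) := by ring

/-! ## First derivatives along the time and the spatial lines -/

/-- **Time derivative of a weighted Laplace–Fourier integral**: for `t > 0`, `|g| ≤ 1` measurable,
`d/ds|_{s=t} ∫ W e^{−sE} g dμ = −∫ W E e^{−tE} g dμ`. -/
theorem hasDerivAt_weight_time (h0 : μ (Set.Iio (0 : ℝ) ×ˢ (Set.univ : Set E3)) = 0)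
    (hint : ∀ t : ℝ, 0 < t → Integrable (fun p : ℝ × E3 => Real.exp (-(t * p.1))) μ)
    {W : ℝ × E3 → ℝ} (hWm : Measurable W) {C : ℝ} {m : ℕ} (hC : 0 ≤ C) (hWb : ∀ᵐ p ∂μ, |W p| ≤ C * (1 + p.1) ^ m)
    {g : ℝ × E3 → ℝ} (hgm : Measurable g) (hgb : ∀ p, |g p| ≤ 1) {t : ℝ} (ht : 0 < t) :
    HasDerivAt (fun s : ℝ => ∫ p : ℝ × E3, W p * Real.exp (-(s * p.1)) * g p ∂μ)
      (-∫ p : ℝ × E3, W p * p.1 * Real.exp (-(t * p.1)) * g p ∂μ) t := by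
  have hE := ae_nonneg_of_measure_Iio μ h0
  set F : ℝ → ℝ × E3 → ℝ := fun s p => W p * Real.exp (-(s * p.1)) * g p with hF
  set F' : ℝ → ℝ × E3 → ℝ := fun s p => -(W p * p.1 * Real.exp (-(s * p.1)) * g p) with hF'
  have hFm : ∀ s, AEStronglyMeasurable (F s) μ := fun s =>
    ((hWm.mul (by fun_prop)).mul hgm).aestronglyMeasurable
  have hF'm : ∀ s, AEStronglyMeasurable (F' s) μ := fun s =>
    (((hWm.mul measurable_fst).mul (by fun_prop)).mul hgm).neg.aestronglyMeasurable
  have hFint : Integrable (F t) μ := integrable_weight h0 hint hWm hWb hgm hgb ht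
  -- dominating function on `s ∈ (t/2, 2t)`: `|W| E e^{−(t/2)E}`
  have ht2 : 0 < t / 2 := by positivity
  have hbound_int : Integrable (fun p : ℝ × E3 => |W p * p.1| * Real.exp (-(t / 2 * p.1)) * 1) μ := by
    exact integrable_weight h0 hint ((hWm.mul measurable_fst).abs) (C := C) (m := m + 1)
      (by filter_upwards [weight_mul_energy h0 hC hWb] with p hp; rwa [abs_abs]) (g := fun _ => (1 : ℝ)) measurable_const
      (fun _ => by norm_num) ht2
  have hs : Ioo (t / 2) (2 * t) ∈ 𝓝 t := Ioo_mem_nhds (by linarith) (by linarith)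
  have key := hasDerivAt_integral_of_dominated_loc_of_deriv_le (μ := μ) (F := F) (F' := F') (x₀ := t)
    (bound := fun p : ℝ × E3 => |W p * p.1| * Real.exp (-(t / 2 * p.1)) * 1) hs
    (Eventually.of_forall hFm) hFint (hF'm t) ?_ hbound_int ?_
  · have e : ∫ p, F' t p ∂μ = -∫ p : ℝ × E3, W p * p.1 * Real.exp (-(t * p.1)) * g p ∂μ := by
      rw [hF', integral_neg]
    rw [← e]
    exact key.2
  · filter_upwards [hE] with p hp s hs'
    rw [hF']; dsimp only
    rw [norm_neg, Real.norm_eq_abs, abs_mul, abs_mul, abs_of_pos (Real.exp_pos _), mul_one]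
    have h1 : Real.exp (-(s * p.1)) ≤ Real.exp (-(t / 2 * p.1)) := Real.exp_le_exp.2 (by nlinarith [hs'.1])
    calc |W p * p.1| * Real.exp (-(s * p.1)) * |g p| ≤ |W p * p.1| * Real.exp (-(t / 2 * p.1)) * 1 :=
          mul_le_mul (mul_le_mul_of_nonneg_left h1 (abs_nonneg _)) (hgb p) (abs_nonneg _) (by positivity)
      _ = |W p * p.1| * Real.exp (-(t / 2 * p.1)) := mul_one _
  · refine Eventually.of_forall fun p s _ => ?_
    simp only [hF, hF']
    have h1 : HasDerivAt (fun s : ℝ => -(s * p.1)) (-p.1) s := by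
      have h := ((hasDerivAt_id' s).mul_const p.1).neg
      simp only [one_mul] at h
      exact h
    have h2 := (Real.hasDerivAt_exp _).comp s h1
    have h3 := (h2.const_mul (W p)).mul_const (g p)
    refine h3.congr_deriv ?_
    ring

/-- **Spatial derivative of a weighted Laplace–Fourier integral** (when `‖q⃗‖ ≤ E + A` a.e.): for `t > 0`, `g` with `|g|, |g'| ≤ 1`,
`d/ds|_{s₀} ∫ W e^{−tE} g(⟪q⃗,z⃗⟫ + s qⱼ) dμ = ∫ W e^{−tE} qⱼ g'(⟪q⃗,z⃗⟫ + s₀ qⱼ) dμ`. -/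
theorem hasDerivAt_weight_space (h0 : μ (Set.Iio (0 : ℝ) ×ˢ (Set.univ : Set E3)) = 0)
    (hint : ∀ t : ℝ, 0 < t → Integrable (fun p : ℝ × E3 => Real.exp (-(t * p.1))) μ)
    {A : ℝ} (hA : 0 ≤ A) (hq : ∀ᵐ p ∂μ, ‖p.2‖ ≤ p.1 + A)
    {W : ℝ × E3 → ℝ} (hWm : Measurable W) {C : ℝ} {m : ℕ} (hC : 0 ≤ C) (hWb : ∀ᵐ p ∂μ, |W p| ≤ C * (1 + p.1) ^ m)
    (g g' : ℝ → ℝ) (hg : ∀ u, HasDerivAt g (g' u) u) (hgc : Continuous g) (hg'c : Continuous g')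
    (hgb : ∀ u, |g u| ≤ 1) (hg'b : ∀ u, |g' u| ≤ 1) {t : ℝ} (ht : 0 < t) (z : E3) (j : Fin 3) (s₀ : ℝ) :
    HasDerivAt (fun s : ℝ => ∫ p : ℝ × E3, W p * Real.exp (-(t * p.1)) * g (inner ℝ p.2 z + s * p.2 j) ∂μ)
      (∫ p : ℝ × E3, W p * p.2 j * Real.exp (-(t * p.1)) * g' (inner ℝ p.2 z + s₀ * p.2 j) ∂μ) s₀ := by
  set F : ℝ → ℝ × E3 → ℝ := fun s p => W p * Real.exp (-(t * p.1)) * g (inner ℝ p.2 z + s * p.2 j) with hF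
  set F' : ℝ → ℝ × E3 → ℝ := fun s p => W p * p.2 j * Real.exp (-(t * p.1)) * g' (inner ℝ p.2 z + s * p.2 j) with hF'
  have hFm : ∀ s, AEStronglyMeasurable (F s) μ := fun s => by
    refine Measurable.aestronglyMeasurable ?_
    simp only [hF]
    exact (hWm.mul (by fun_prop)).mul (hgc.measurable.comp (by fun_prop))
  have hqj : Measurable fun p : ℝ × E3 => p.2 j := by fun_prop
  have hF'm : ∀ s, AEStronglyMeasurable (F' s) μ := fun s => by
    refine Measurable.aestronglyMeasurable ?_
    simp only [hF']
    exact ((hWm.mul hqj).mul (by fun_prop)).mul (hg'c.measurable.comp (by fun_prop))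
  have hFint : Integrable (F s₀) μ :=
    integrable_weight h0 hint hWm hWb (hgc.measurable.comp (by fun_prop)) (fun p => hgb _) ht
  have hWj := weight_mul_momentum h0 hA hq hC hWb j
  have hbound_int : Integrable (fun p : ℝ × E3 => |W p * p.2 j| * Real.exp (-(t * p.1)) * 1) μ :=
    integrable_weight h0 hint ((hWm.mul hqj).abs) (C := C * (1 + A)) (m := m + 1)
      (by filter_upwards [hWj] with p hp; rwa [abs_abs]) (g := fun _ => (1 : ℝ)) measurable_const (fun _ => by norm_num) ht
  have key := hasDerivAt_integral_of_dominated_loc_of_deriv_le (μ := μ) (F := F) (F' := F') (x₀ := s₀) (s := univ)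
    (bound := fun p : ℝ × E3 => |W p * p.2 j| * Real.exp (-(t * p.1)) * 1) univ_mem
    (Eventually.of_forall hFm) hFint (hF'm s₀) ?_ hbound_int ?_
  · simpa [hF, hF'] using key.2
  · refine Eventually.of_forall fun p s _ => ?_
    rw [hF']; dsimp only
    rw [Real.norm_eq_abs, abs_mul, abs_mul, abs_of_pos (Real.exp_pos _), mul_one]
    calc |W p * p.2 j| * Real.exp (-(t * p.1)) * |g' (inner ℝ p.2 z + s * p.2 j)| ≤ |W p * p.2 j| * Real.exp (-(t * p.1)) * 1 :=
          mul_le_mul_of_nonneg_left (hg'b _) (by positivity)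
      _ = |W p * p.2 j| * Real.exp (-(t * p.1)) := mul_one _
  · refine Eventually.of_forall fun p s _ => ?_
    simp only [hF, hF']
    have hlin : HasDerivAt (fun s : ℝ => inner ℝ p.2 z + s * p.2 j) (p.2 j) s := by
      simpa using (hasDerivAt_id s).mul_const (p.2 j) |>.const_add (inner ℝ p.2 z)
    have hcomp := (hg (inner ℝ p.2 z + s * p.2 j)).comp s hlin
    have h2 := hcomp.const_mul (W p * Real.exp (-(t * p.1)))
    exact h2.congr_deriv (by ring)

end Summit.QuantumFields.YangMills.Theorems.F4SubCurvatureDoorShellSeparationProof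

end
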